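import Literature.Probability.LatticeModels.GaussianPairingBoundCouplings
import Literature.Probability.LatticeModels.AizenmanWickBound
import HarnessLib

/-!
# Aizenman's deviation from Wick's law (Prop. 12.1) for general ferromagnetic pair couplings,
# from the unit-coupling finite-graph statement

Topic `Literature/Probability/LatticeModels`. `AizenmanWickBound.lean` vendors Aizenman's
Proposition 12.1 (Comm. Math. Phys. 86 (1982), eq. (12.3): `|S_{2n} - G_{2n}| ≤ (3/2) R_{2n}`,
`R_{2n} = ∑_{4-subsets} |U₄| G_{2n-4}`) as the named fact `aizenman_wickDeviation_le_finite` for the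
free zero-field Ising model with the SAME coupling `β ≥ 0` on every edge of an arbitrary finite
simple graph. Aizenman proves it "for finite systems of Ising spins, with a general two point
ferromagnetic interaction" (p. 37), and the long-range triviality barrier needs that generality
(`Literature.Barriers.CriticalPhenomena.aizenman_pairInteraction_wickDeviation_le_finite` of
`Literature/Barriers/CriticalPhenomena/LongRangeTrivialityOnZ3Wick.lean`). This file PROVES the
implication

  `aizenman_wickDeviation_le_finite → (Prop. 12.1 for every pair coupling c ≥ 0 on a finite set)`

(`PairIsing.wickDeviation_le`), by the decoration transformation of
`GaussianPairingBoundCouplings.lean`: the statement at `2n` sites only involves correlations of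
those sites, so on the decorated graph `decorGraph k` (uniform coupling `β₀`) it restricts to the
`ι`-marginal, which is exactly the pair-interaction average with couplings `K(β₀)k`
(`isingExpect_decorGraph_comp_inl`); then `K_m⌊c/K_m⌋₊ → c` and every term is continuous in the
couplings (`continuous_avg`, `tendsto_pairingSum`, `tendsto_wickRemainder`). So the two named facts
(unit coupling / general pair interaction) are ONE input, shared with the nearest-neighbour
`d ≥ 4` barrier `IsingTrivialityFromDimensionFour`.

Also: `PairIsing.ursellFour c u = ⟨σ_{u₀}σ_{u₁}σ_{u₂}σ_{u₃}⟩ - ∑ ⟨σσ⟩⟨σσ⟩` (the shape of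
`connectedFour` / `LongRangeIsing.ursellFourIn`), `PairIsing.exists_decor_approx` (the approximating
decorated couplings, packaged).

## References

* M. Aizenman, Comm. Math. Phys. 86 (1982) 1–48, Prop. 12.1, eq. (12.3), p. 37 ("with a general two
  point ferromagnetic interaction") [AizenmanCMP1982] — through `AizenmanWickBound.lean`.
* M. Aizenman, CDM 2020, Prop. 7.2, eq. (7.1) [AizenmanCDM2020]; R. Panis, arXiv:2309.05797, Prop. 4.6
  [Panis2023Triviality] (the general-interaction statement).
* C. M. Newman, Z. Wahrsch. verw. Gebiete 33 (1975), Theorem 3 [Newman1975Gaussian] (the Gaussian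
  half, proved unconditionally in `GaussianPairingBoundCouplings`).

## Not here

The unit-coupling fact itself (random currents / random-walk representation) is NOT proved. The
specialisation to `LongRangeIsing.expectIn` on `ℤ^d` is in
`Literature/Barriers/CriticalPhenomena/LongRangeTrivialityOnZ3WickReduction.lean`.
-/

noncomputable section

open MeasureTheory Finset Filter Topology
open scoped Nat

namespace Literature.Probability.LatticeModels

namespace PairIsing

section General

variable {ι : Type*} [Fintype ι] [DecidableEq ι]

/-- The four-point Ursell function of the pair-interaction average,
`U₄^c(u₀,u₁,u₂,u₃) = ⟨σ_{u₀}σ_{u₁}σ_{u₂}σ_{u₃}⟩_c - ⟨σ_{u₀}σ_{u₁}⟩_c⟨σ_{u₂}σ_{u₃}⟩_c -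
⟨σ_{u₀}σ_{u₂}⟩_c⟨σ_{u₁}σ_{u₃}⟩_c - ⟨σ_{u₀}σ_{u₃}⟩_c⟨σ_{u₁}σ_{u₂}⟩_c` (the shape of `connectedFour`).
[cite: AizenmanCMP1982, Prop. 12.1 (U₄ in R_{2n}, p. 37)] -/
def ursellFour (c : ι → ι → ℝ) (u : Fin 4 → ι) : ℝ :=
  avg c (spinMonomial u) - avg c (spinPair (u 0) (u 1)) * avg c (spinPair (u 2) (u 3)) -
    avg c (spinPair (u 0) (u 2)) * avg c (spinPair (u 1) (u 3)) -
      avg c (spinPair (u 0) (u 3)) * avg c (spinPair (u 1) (u 2))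

/-- Unfolding of `ursellFour`. [folklore] -/
theorem ursellFour_def (c : ι → ι → ℝ) (u : Fin 4 → ι) :
    ursellFour c u = avg c (spinMonomial u) - avg c (spinPair (u 0) (u 1)) * avg c (spinPair (u 2) (u 3)) -
      avg c (spinPair (u 0) (u 2)) * avg c (spinPair (u 1) (u 3)) -
        avg c (spinPair (u 0) (u 3)) * avg c (spinPair (u 1) (u 2)) := rfl

/-- `U₄` does not see the diagonal couplings. [folklore] -/
theorem ursellFour_offDiag (c : ι → ι → ℝ) (u : Fin 4 → ι) : ursellFour (offDiag c) u = ursellFour c u := by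
  simp only [ursellFour, avg_offDiag]

/-- `U₄` does not see the diagonal couplings (function form). [folklore] -/
theorem ursellFour_offDiag_eq (c : ι → ι → ℝ) : ursellFour (offDiag c) = ursellFour c :=
  funext (ursellFour_offDiag c)

/-- `U₄^c(u)` is continuous in the couplings. [folklore] -/
theorem continuous_ursellFour (u : Fin 4 → ι) : Continuous fun c : ι → ι → ℝ => ursellFour c u := by
  unfold ursellFour
  exact (((continuous_avg _).sub ((continuous_avg _).mul (continuous_avg _))).sub
    ((continuous_avg _).mul (continuous_avg _))).sub ((continuous_avg _).mul (continuous_avg _))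

/-- **Correlations of site spins in the decorated model are pair-interaction averages**
(`n`-point form of `isingExpect_decorGraph_comp_inl`). [folklore] -/
theorem nPoint_decorGraph_inl {k : ι → ι → ℕ} (hk : ∀ a, k a a = 0) (β₀ : ℝ) {m : ℕ} (y : Fin m → ι) :
    nPoint (isingMeasure (decorGraph k) univ β₀ 0 .free) spinAt (Sum.inl ∘ y) =
      avg (fun a b => decorK β₀ * k a b) (spinMonomial y) := by
  rw [← isingExpect_decorGraph_comp_inl hk β₀ (spinMonomial y)]
  rfl

/-- Two-point form of `isingExpect_decorGraph_comp_inl`. [folklore] -/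
theorem twoPoint_decorGraph_inl {k : ι → ι → ℕ} (hk : ∀ a, k a a = 0) (β₀ : ℝ) (a b : ι) :
    twoPoint (isingMeasure (decorGraph k) univ β₀ 0 .free) spinAt (Sum.inl a) (Sum.inl b) =
      avg (fun a b => decorK β₀ * k a b) (spinPair a b) := by
  rw [← isingExpect_decorGraph_comp_inl hk β₀ (spinPair a b)]
  rfl

/-- Four-point Ursell form of `isingExpect_decorGraph_comp_inl`. [folklore] -/
theorem connectedFour_decorGraph_inl {k : ι → ι → ℕ} (hk : ∀ a, k a a = 0) (β₀ : ℝ) (u : Fin 4 → ι) :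
    connectedFour (isingMeasure (decorGraph k) univ β₀ 0 .free) spinAt (Sum.inl ∘ u) =
      ursellFour (fun a b => decorK β₀ * k a b) u := by
  rw [connectedFour, ursellFour, nPoint_decorGraph_inl hk]
  simp only [Function.comp_apply, twoPoint_decorGraph_inl hk]

omit [Fintype ι] in
/-- **The approximating decorated couplings, packaged**: for `c` nonnegative off the diagonal there
are `β₀(m) ≥ 0` and integer multiplicities `k_m` vanishing on the diagonal with
`K(β₀(m))·k_m → offDiag c` (namely `β₀(m) = 1/(m+1)`, `k_m = ⌊c/K_m⌋₊`). [folklore] -/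
theorem exists_decor_approx (c : ι → ι → ℝ) (hc : ∀ a b, a ≠ b → 0 ≤ c a b) :
    ∃ (β₀ : ℕ → ℝ) (k : ℕ → ι → ι → ℕ), (∀ m, 0 ≤ β₀ m) ∧ (∀ m a, k m a a = 0) ∧
      Tendsto (fun m a b => decorK (β₀ m) * (k m a b : ℝ)) atTop (𝓝 (offDiag c)) := by
  refine ⟨fun m => 1 / ((m : ℝ) + 1), fun m a b => if a = b then 0 else ⌊c a b / decorK (1 / ((m : ℝ) + 1))⌋₊,
    fun m => by positivity, fun m a => by simp, ?_⟩
  rw [tendsto_pi_nhds]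
  intro a
  rw [tendsto_pi_nhds]
  intro b
  by_cases hab : a = b
  · simp only [offDiag, if_pos hab, Nat.cast_zero, mul_zero]
    exact tendsto_const_nhds
  · simp only [offDiag, if_neg hab]
    exact tendsto_decorK_mul_floor (hc a b hab)

end General

section UnitCoupling

variable {ι : Type} [Fintype ι] [DecidableEq ι]

/-- **Prop. 12.1 for decorated couplings** `K(β₀)k` (`k` integer, zero diagonal, `β₀ ≥ 0`), granted the
unit-coupling finite-graph fact: restrict `aizenman_wickDeviation_le_finite` on `decorGraph k` to the
sites `ι`. [cite: AizenmanCMP1982, Prop. 12.1, eq. (12.3) (p. 37)] -/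
theorem wickDeviation_le_decor (hW : aizenman_wickDeviation_le_finite) {k : ι → ι → ℕ}
    (hk : ∀ a, k a a = 0) {β₀ : ℝ} (hβ₀ : 0 ≤ β₀) {n : ℕ} (hn : 2 ≤ n) (x : Fin (2 * n) → ι) :
    |avg (fun a b => decorK β₀ * k a b) (spinMonomial x) -
        pairingSum (fun a b => avg (fun a b => decorK β₀ * k a b) (spinPair a b)) n x| ≤
      3 / 2 * wickRemainder (fun a b => avg (fun a b => decorK β₀ * k a b) (spinPair a b))
        (ursellFour fun a b => decorK β₀ * k a b) n x := by
  classical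
  have h := hW (ι ⊕ Decor k) (decorGraph k) β₀ hβ₀ n hn (Sum.inl ∘ x)
  have h2 : ∀ i j, twoPoint (isingMeasure (decorGraph k) univ β₀ 0 .free) spinAt ((Sum.inl ∘ x) i) ((Sum.inl ∘ x) j) =
      avg (fun a b => decorK β₀ * k a b) (spinPair (x i) (x j)) := fun i j => twoPoint_decorGraph_inl hk β₀ _ _
  rw [nPoint_decorGraph_inl hk, pairingSum_congr_of_eq _ (fun a b => avg (fun a b => decorK β₀ * k a b) (spinPair a b))
      n (Sum.inl ∘ x) x h2,
    wickRemainder_congr_of_eq _ (fun a b => avg (fun a b => decorK β₀ * k a b) (spinPair a b)) _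
      (ursellFour fun a b => decorK β₀ * k a b) n (Sum.inl ∘ x) x h2
      (fun e => connectedFour_decorGraph_inl hk β₀ (x ∘ e))] at h
  exact h

/-- **Aizenman's Proposition 12.1 for a general ferromagnetic pair interaction on a finite set,
granted its unit-coupling finite-graph form.** For off-diagonal couplings `c_{a,b} ≥ 0`, `n ≥ 2`
and any `2n` sites (repetitions allowed),
`|⟨σ_{x₁}⋯σ_{x₂ₙ}⟩_c - 𝒢_n[⟨σσ⟩_c](x)| ≤ (3/2) ∑_{4-subsets s} |U₄^c(x|_s)| 𝒢_{n-2}[⟨σσ⟩_c](x|_{sᶜ})`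
("it suffices to prove (12.3) for finite systems of Ising spins, with a general two point
ferromagnetic interaction", Aizenman 1982, p. 37): decorated couplings `K_m⌊c/K_m⌋₊ → c` and
continuity of every term in the couplings. [cite: AizenmanCMP1982, Prop. 12.1, eq. (12.3) (p. 37)] -/
theorem wickDeviation_le (hW : aizenman_wickDeviation_le_finite) (c : ι → ι → ℝ)
    (hc : ∀ a b, a ≠ b → 0 ≤ c a b) {n : ℕ} (hn : 2 ≤ n) (x : Fin (2 * n) → ι) :
    |avg c (spinMonomial x) - pairingSum (fun a b => avg c (spinPair a b)) n x| ≤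
      3 / 2 * wickRemainder (fun a b => avg c (spinPair a b)) (ursellFour c) n x := by
  classical
  obtain ⟨β₀, k, hβ₀, hk, hconv⟩ := exists_decor_approx c hc
  set cn : ℕ → ι → ι → ℝ := fun m a b => decorK (β₀ m) * (k m a b : ℝ) with hcn
  have hconv' : Tendsto cn atTop (𝓝 (offDiag c)) := hconv
  have havg : ∀ f : SpinConfig ι → ℝ, Tendsto (fun m => avg (cn m) f) atTop (𝓝 (avg (offDiag c) f)) :=
    fun f => ((continuous_avg f).tendsto _).comp hconv'
  have hineq : ∀ m, |avg (cn m) (spinMonomial x) - pairingSum (fun a b => avg (cn m) (spinPair a b)) n x| ≤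
      3 / 2 * wickRemainder (fun a b => avg (cn m) (spinPair a b)) (ursellFour (cn m)) n x :=
    fun m => wickDeviation_le_decor hW (hk m) (hβ₀ m) hn x
  have hl : Tendsto (fun m => |avg (cn m) (spinMonomial x) - pairingSum (fun a b => avg (cn m) (spinPair a b)) n x|)
      atTop (𝓝 |avg (offDiag c) (spinMonomial x) - pairingSum (fun a b => avg (offDiag c) (spinPair a b)) n x|) :=
    ((havg _).sub (tendsto_pairingSum (fun a b => havg (spinPair a b)) n x)).abs
  have hr : Tendsto (fun m => 3 / 2 * wickRemainder (fun a b => avg (cn m) (spinPair a b)) (ursellFour (cn m)) n x)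
      atTop (𝓝 (3 / 2 * wickRemainder (fun a b => avg (offDiag c) (spinPair a b)) (ursellFour (offDiag c)) n x)) :=
    (tendsto_wickRemainder (fun a b => havg (spinPair a b))
      (fun u => ((continuous_ursellFour u).tendsto _).comp hconv') n x).const_mul _
  have hlim := le_of_tendsto_of_tendsto' hl hr hineq
  simpa only [avg_offDiag, ursellFour_offDiag_eq] using hlim

end UnitCoupling

end PairIsing

end Literature.Probability.LatticeModels

end
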